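import Summits.HubbardSuperconductivity.HubbardSuperconductivity.Theorems.BalabanIRBirComplexStableXYRGaussianPhase
import Summits.HubbardSuperconductivity.HubbardSuperconductivity.Theorems.BalabanIRBirComplexStableXYRResistance
import Summits.HubbardSuperconductivity.HubbardSuperconductivity.Theorems.BalabanIRBirComplexStableXYRGaussianCoercive
import Summits.HubbardSuperconductivity.HubbardSuperconductivity.Theorems.BalabanIRBirComplexStableXYRGaussianReality
import Summits.HubbardSuperconductivity.HubbardSuperconductivity.Theorems.BalabanIRBirComplexStableXYFixedVolumeAction
import Summits.HubbardSuperconductivity.HubbardSuperconductivity.Theorems.BalabanIRBirComplexStableXYFixedVolumeExpansion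
import Summits.HubbardSuperconductivity.HubbardSuperconductivity.Theorems.BalabanIRBirComplexStableXYFixedVolumeTorus
import HarnessLib

/-!
# Crux `BirComplexStableXYR` (stmt-HubbardSuperconductivity-14845): THE GAUSSIAN BACKBONE —
# spin-wave theory of an arbitrary admissible table has slice order `≥ 1 − 32/(c₀K)`, uniformly in `L ≤ M`

Support file (prover seat 0, route BalabanIR) for the restated engine
`…Theses.BalabanIR.BirComplexStableXYR` (third of three files; `…RGaussianPhase`, `…RResistance`).

For a table `c` with (N) and (C) (constant `c₀ > 0`, window `r ≥ 2`) the translate-summed Hessian of the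
action at the aligned configuration is the real quadratic form
`Q_c(u) = Re(−Σ_s Σ_n c_n (n·(u∘sh s))²)` on fields `u : (ℤ/L)² × ℤ/M → ℝ` (real under (R)∧(P) by
`gaussianReality`, and `⪰ c₀ ×` the nearest-neighbour Dirichlet form by `gaussianCoercive`).  The
HARMONIC (spin-wave) approximation of the crux's complex measure `e^{−A}dθ` at stiffness `K` is the
Gaussian `dγ(v) ∝ exp(−(K/2)·Q_c(ext v)) dv` on `ℝ^{Λ∖0}` (the global rotation pinned at the origin,
`ext` = extension by zero).  We prove, for the crux's slice observable
`O(θ) = |Σ_x e^{iθ(x,0)}|²/L⁴` taken verbatim: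

  `birComplexStableXYR_spinWave`:  `0 < ∫γ`  and  `(1 − 32/(c₀K)) · ∫γ ≤ ∫ O(ext v) dγ(v)`

for EVERY `K > 0` and ALL `L ≤ M` — slice order `≥ 1/2` at the Gaussian level as soon as `K ≥ 64/c₀`,
uniformly in the anisotropy (the modes with zero spatial momentum, which soften as `M → ∞` and drive the
Beraha–Kahane–Weiss zeros of the unrestated engine, never enter an equal-time difference).  Ingredients:
the Gaussian characteristic function with its variational bound (`gph_cos_integral_ge'`), the effective
resistance bound `(u(x,0) − u(y,0))² ≤ 64·D(u)` (`BirSpinWave.res_resistance_bound_zmod`), coercivity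
`Q_c ≥ c₀ D` (`gaussianCoercive`), whence `2ℓ − K Q_c ≤ 64/(c₀K)` for `ℓ = u(x,0) − u(y,0)`, and
`|Σ_x e^{iθ_x}|² = Σ_{x,y} cos(θ_x − θ_y)`.  This is the `K = ∞` endpoint that every multiscale line for
the crux must reproduce; no definitions. [folklore]
-/

noncomputable section

namespace Summit.HubbardSuperconductivity.HubbardSuperconductivity.Theorems

open scoped BigOperators Matrix ComplexConjugate
open MeasureTheory Complex Summit.HubbardSuperconductivity.BirComplexStableXYNegative
open Literature.Probability.LatticeModels

section SpinWave

variable {r : ℕ}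

/-- `|Σ_x e^{iθ_x}|² = Σ_x Σ_y cos(θ_x − θ_y)`. [folklore] -/
theorem sw_norm_sq_sum_cexp {α : Type*} [Fintype α] (θ : α → ℝ) :
    ‖∑ x, cexp (I * (θ x : ℂ))‖ ^ 2 = ∑ x, ∑ y, Real.cos (θ x - θ y) := by
  set S : ℂ := ∑ x, cexp (I * (θ x : ℂ)) with hS
  have h1 : ((‖S‖ ^ 2 : ℝ) : ℂ) = S * conj S := by
    rw [Complex.mul_conj, Complex.normSq_eq_norm_sq]
  have h2 : S * conj S = ∑ x, ∑ y, cexp (I * (θ x : ℂ)) * conj (cexp (I * (θ y : ℂ))) := by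
    rw [hS, map_sum, Finset.sum_mul_sum]
  have h3 : ∀ x y, cexp (I * (θ x : ℂ)) * conj (cexp (I * (θ y : ℂ))) =
      cexp (((θ x - θ y : ℝ) : ℂ) * I) := by
    intro x y
    rw [← Complex.exp_conj, map_mul, Complex.conj_I, Complex.conj_ofReal, ← Complex.exp_add]
    congr 1
    push_cast
    ring
  have h4 : ‖S‖ ^ 2 = (S * conj S).re := by rw [← h1, Complex.ofReal_re]
  rw [h4, h2, Complex.re_sum]
  refine Finset.sum_congr rfl fun x _ => ?_
  rw [Complex.re_sum]
  refine Finset.sum_congr rfl fun y _ => ?_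
  rw [h3, Complex.exp_ofReal_mul_I_re]

/-- `2ℓ − aℓ² ≤ 1/a` for `a > 0`. [folklore] -/
theorem sw_quad_bound {a : ℝ} (ha : 0 < a) (ℓ : ℝ) : 2 * ℓ - a * ℓ ^ 2 ≤ 1 / a := by
  have h : 0 ≤ a * (ℓ - 1 / a) ^ 2 := by positivity
  have h' : a * (ℓ - 1 / a) ^ 2 = a * ℓ ^ 2 - 2 * ℓ + 1 / a := by
    field_simp
    ring
  linarith [h, h']

/-- **A real quadratic expression in matrix form**: for complex weights `wt_k` and real linear forms
`a_k·v`, `Re(−Σ_k wt_k (a_k·v)²) = v ⬝ᵥ A v` with `A_{ij} = Re(−Σ_k wt_k a_{ki} a_{kj})`. [folklore] -/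
theorem sw_re_neg_sum_sq_eq_matrix {κ J : Type*} [Fintype κ] [Fintype J] (wt : κ → ℂ) (a : κ → J → ℝ)
    (v : J → ℝ) :
    (-∑ k, wt k * ((∑ j, a k j * v j : ℝ) : ℂ) ^ 2).re =
      v ⬝ᵥ ((Matrix.of fun i j : J => (-(∑ k, wt k * (a k i : ℂ) * (a k j : ℂ))).re) *ᵥ v) := by
  have hquad := birExpand_quad_eq_matrix wt a v
  have hneg : (-∑ k, wt k * ((∑ j, a k j * v j : ℝ) : ℂ) ^ 2) =
      ∑ i, ∑ j, (-(∑ k, wt k * a k i * a k j)) * v i * v j := by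
    have h2 : (-∑ k, wt k * ((∑ j, a k j * v j : ℝ) : ℂ) ^ 2) =
        2 * (-(1 / 2 : ℂ) * ∑ k, wt k * ((∑ j, a k j * v j : ℝ) : ℂ) ^ 2) := by ring
    rw [h2, hquad]; ring
  rw [hneg]
  have hform := birGauss_form_re_im (Matrix.of fun i j : J => -(∑ k, wt k * (a k i : ℂ) * (a k j : ℂ))) v
  simp only [Matrix.of_apply] at hform
  rw [hform, Complex.add_re, Complex.ofReal_re, Complex.I_mul_re, Complex.ofReal_im, neg_zero, add_zero]

/-- The same matrix is symmetric. [folklore] -/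
theorem sw_matrix_isHermitian {κ J : Type*} [Fintype κ] (wt : κ → ℂ) (a : κ → J → ℝ) :
    (Matrix.of fun i j : J => (-(∑ k, wt k * (a k i : ℂ) * (a k j : ℂ))).re).IsHermitian := by
  have hs := birExpand_matrix_isSymm wt a
  have hQsym : ∀ i j : J,
      (-(∑ k, wt k * (a k j : ℂ) * (a k i : ℂ)) : ℂ) = -(∑ k, wt k * (a k i : ℂ) * (a k j : ℂ)) :=
    fun i j => by simpa using congrFun (congrFun hs i) j
  ext i j
  rw [Matrix.conjTranspose_apply, Matrix.of_apply, Matrix.of_apply, star_trivial, hQsym i j]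

variable {L M : ℕ} [NeZero L] [NeZero M]

/-- **The pinned Hessian is a matrix quadratic form.**  With `κ = Λ × supp c`, weights `c_n` and forms
`a_{(s,n)}(j) = Σ_w n_w [sh s w = j]`:
`Re(−Σ_s Σ_n c_n (n·(ext v ∘ sh s))²) = v ⬝ᵥ A v`, `A_{ij} = Re(−Σ_k c_{k.2} a_{ki} a_{kj})`. [folklore] -/
theorem sw_pinned_form_eq_matrix (c : Table r) (v : {i : Λ L M // i ≠ 0} → ℝ) :
    (-∑ s : Λ L M, c.sum (fun n a => a * (((∑ w, (n w : ℝ) *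
        (fun i => if h : i = (0 : Λ L M) then (0 : ℝ) else v ⟨i, h⟩) (sh L M s w)) ^ 2 : ℝ) : ℂ))).re =
      v ⬝ᵥ ((Matrix.of fun i j : {i : Λ L M // i ≠ 0} =>
        (-(∑ k : Λ L M × ↥c.support, c k.2 *
          ((∑ w, ((k.2 : Freq r) w : ℝ) * (if sh L M k.1 w = i.1 then (1 : ℝ) else 0) : ℝ) : ℂ) *
          ((∑ w, ((k.2 : Freq r) w : ℝ) * (if sh L M k.1 w = j.1 then (1 : ℝ) else 0) : ℝ) : ℂ))).re) *ᵥ v) := by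
  have hsum : (∑ s : Λ L M, c.sum (fun n a => a * (((∑ w, (n w : ℝ) *
      (fun i => if h : i = (0 : Λ L M) then (0 : ℝ) else v ⟨i, h⟩) (sh L M s w)) ^ 2 : ℝ) : ℂ))) =
      ∑ k : Λ L M × ↥c.support, c k.2 *
        ((∑ j, (∑ w, ((k.2 : Freq r) w : ℝ) * (if sh L M k.1 w = j.1 then (1 : ℝ) else 0)) * v j : ℝ) : ℂ) ^ 2 := by
    conv_rhs => rw [Fintype.sum_prod_type]
    refine Fintype.sum_congr _ _ fun s => ?_
    rw [Finsupp.sum, ← Finset.sum_coe_sort]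
    refine Fintype.sum_congr _ _ fun n => ?_
    dsimp only
    rw [birAct_form_eq (0 : Λ L M) v (sh L M) s (n : Freq r)]
    push_cast
    ring
  rw [hsum]
  have key := sw_re_neg_sum_sq_eq_matrix (fun k : Λ L M × ↥c.support => c k.2)
    (fun k j => ∑ w, ((k.2 : Freq r) w : ℝ) * (if sh L M k.1 w = j.1 then (1 : ℝ) else 0)) v
  beta_reduce at key
  exact key

/-- **THE GAUSSIAN BACKBONE of the restated engine.**  For a table with (N) and (C) (`c₀ > 0`, `r ≥ 2`),
every `K > 0` and all `L ≤ M`: the pinned harmonic measure `dγ ∝ exp(−(K/2)·Re H_c^Σ(ext v)) dv` has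
positive mass and its slice order is at least `1 − 32/(c₀K)`:
`(1 − 32/(c₀K)) ∫γ ≤ ∫ |Σ_x e^{i(ext v)(x,0)}|²/L⁴ dγ(v)` — the spin-wave prediction for the crux's slice
observable is `≥ 1/2` for `K ≥ 64/c₀`, uniformly in the volume and the anisotropy. [folklore] -/
theorem birComplexStableXYR_spinWave (hr : 2 ≤ r) (c : Table r) {c₀ : ℝ} (hc₀ : 0 < c₀)
    (hN : c.sum (fun _ a => a) = 0)
    (hC : ∀ φ : W r → ℝ, c₀ * ∑ w, ∑ w', (1 - Real.cos (φ w - φ w')) ≤ (genF c φ).re)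
    {K : ℝ} (hK : 0 < K) (L M : ℕ) [NeZero L] [NeZero M] (hLM : L ≤ M) :
    let Q : (Λ L M → ℝ) → ℝ := fun u =>
      (-∑ s : Λ L M, c.sum (fun n a => a * (((∑ w, (n w : ℝ) * u (sh L M s w)) ^ 2 : ℝ) : ℂ))).re
    let ext : ({i : Λ L M // i ≠ 0} → ℝ) → Λ L M → ℝ := fun v i => if h : i = 0 then 0 else v ⟨i, h⟩
    let g : ({i : Λ L M // i ≠ 0} → ℝ) → ℝ := fun v => Real.exp (-(K / 2) * Q (ext v))
    let O : (Λ L M → ℝ) → ℝ := fun θ =>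
      ‖∑ x : TorusSite 2 L, cexp (I * (θ (x, 0) : ℂ))‖ ^ 2 / (L : ℝ) ^ 4
    0 < ∫ v, g v ∧ (1 - 32 / (c₀ * K)) * ∫ v, g v ≤ ∫ v, O (ext v) * g v := by
  intro Q ext g O
  -- the Dirichlet form, coercivity and its kernel
  set D : (Λ L M → ℝ) → ℝ := fun u => ∑ s : Λ L M,
    ((u s - u (s + (![1, 0], 0))) ^ 2 + (u s - u (s + (![0, 1], 0))) ^ 2 + (u s - u (s + (0, 1))) ^ 2)
    with hD
  have hDnn : ∀ u, 0 ≤ D u := fun u => Finset.sum_nonneg fun s _ => by positivity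
  have hcoer : ∀ v, c₀ * D (ext v) ≤ Q (ext v) := fun v => gaussianCoercive hr c hc₀ hN hC L M (ext v)
  have hDpos : ∀ v, v ≠ 0 → 0 < D (ext v) := by
    intro v hv
    refine lt_of_le_of_ne (hDnn _) fun h0 => hv ?_
    have hterms := (Finset.sum_eq_zero_iff_of_nonneg (fun s _ => by positivity)).1 h0.symm
    refine birLat_eq_zero_of_diff (0 : Λ L M) v fun s e he => ?_
    have hs := hterms s (Finset.mem_univ s)
    have h1 : ext v s - ext v (s + (![1, 0], 0)) = 0 := by nlinarith
    have h2 : ext v s - ext v (s + (![0, 1], 0)) = 0 := by nlinarith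
    have h3 : ext v s - ext v (s + (0, 1)) = 0 := by nlinarith
    simp only [Set.mem_insert_iff, Set.mem_singleton_iff] at he
    rcases he with rfl | rfl | rfl
    · exact h1
    · exact h2
    · exact h3
  -- the matrix of the pinned form and the Gaussian weight
  set A : Matrix {i : Λ L M // i ≠ 0} {i : Λ L M // i ≠ 0} ℝ := Matrix.of fun i j =>
    (-(∑ k : Λ L M × ↥c.support, c k.2 *
      ((∑ w, ((k.2 : Freq r) w : ℝ) * (if sh L M k.1 w = i.1 then (1 : ℝ) else 0) : ℝ) : ℂ) *
      ((∑ w, ((k.2 : Freq r) w : ℝ) * (if sh L M k.1 w = j.1 then (1 : ℝ) else 0) : ℝ) : ℂ))).re with hA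
  have hQA : ∀ v, Q (ext v) = v ⬝ᵥ (A *ᵥ v) := fun v => sw_pinned_form_eq_matrix c v
  set S : Matrix {i : Λ L M // i ≠ 0} {i : Λ L M // i ≠ 0} ℝ := K • A with hS
  have hSv : ∀ v, v ⬝ᵥ (S *ᵥ v) = K * Q (ext v) := by
    intro v
    rw [hQA, hS, Matrix.smul_mulVec, dotProduct_smul, smul_eq_mul]
  have hAh : A.IsHermitian := by
    have h := sw_matrix_isHermitian (fun k : Λ L M × ↥c.support => c k.2)
      (fun (k : Λ L M × ↥c.support) (j : {i : Λ L M // i ≠ 0}) =>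
        ∑ w, ((k.2 : Freq r) w : ℝ) * (if sh L M k.1 w = j.1 then (1 : ℝ) else 0))
    beta_reduce at h
    rw [hA]
    exact h
  have hSh : S.IsHermitian := by
    rw [hS]
    unfold Matrix.IsHermitian
    rw [Matrix.conjTranspose_smul, star_trivial, hAh.eq]
  have hSpd : S.PosDef := by
    refine Matrix.PosDef.of_dotProduct_mulVec_pos hSh fun v hv => ?_
    have key : 0 < v ⬝ᵥ (S *ᵥ v) := by
      rw [hSv v]
      have := hcoer v
      have := hDpos v hv
      nlinarith [mul_pos hK (mul_pos hc₀ (hDpos v hv))]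
    simpa using key
  have hg : ∀ v, g v = Real.exp (-(1 / 2) * (v ⬝ᵥ (S *ᵥ v))) := by
    intro v
    show Real.exp (-(K / 2) * Q (ext v)) = _
    rw [hSv]; ring_nf
  have hZpos : 0 < ∫ v, g v := by
    simp_rw [hg]; exact gph_gauss_pos hSpd
  refine ⟨hZpos, ?_⟩
  -- the bound for one pair of slice sites
  have hpair : ∀ x y : TorusSite 2 L,
      (1 - 32 / (c₀ * K)) * ∫ v, g v ≤ ∫ v, Real.cos (ext v (x, 0) - ext v (y, 0)) * g v := by
    intro x y
    set b : {i : Λ L M // i ≠ 0} → ℝ := fun j =>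
      (if ((x, 0) : Λ L M) = j.1 then (1 : ℝ) else 0) - (if ((y, 0) : Λ L M) = j.1 then (1 : ℝ) else 0)
      with hb
    have hbv : ∀ v, b ⬝ᵥ v = ext v (x, 0) - ext v (y, 0) := by
      intro v
      simp only [dotProduct, hb, sub_mul, Finset.sum_sub_distrib]
      rw [birAct_sum_ite_mul_eq_ext (0 : Λ L M) v (x, 0), birAct_sum_ite_mul_eq_ext (0 : Λ L M) v (y, 0)]
    have hGv : ∀ v, 2 * (b ⬝ᵥ v) - v ⬝ᵥ (S *ᵥ v) ≤ 64 / (c₀ * K) := by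
      intro v
      rw [hbv, hSv]
      by_cases hL2 : 2 ≤ L
      · have hres := BirSpinWave.res_resistance_bound_zmod hL2 hLM (ext v) x y 0
        have hKQ : K * (c₀ * ((ext v (x, 0) - ext v (y, 0)) ^ 2 / 64)) ≤ K * Q (ext v) := by
          refine mul_le_mul_of_nonneg_left ?_ hK.le
          refine le_trans ?_ (hcoer v)
          refine mul_le_mul_of_nonneg_left ?_ hc₀.le
          have : (ext v (x, 0) - ext v (y, 0)) ^ 2 ≤ 64 * D (ext v) := hres
          linarith
        have hq := sw_quad_bound (a := K * c₀ / 64) (by positivity) (ext v (x, 0) - ext v (y, 0))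
        have h64 : 1 / (K * c₀ / 64) = 64 / (c₀ * K) := by
          field_simp
        rw [h64] at hq
        have : K * (c₀ * ((ext v (x, 0) - ext v (y, 0)) ^ 2 / 64)) =
            K * c₀ / 64 * (ext v (x, 0) - ext v (y, 0)) ^ 2 := by ring
        linarith
      · -- `L = 1`: the slice is a single site
        have hL1 : L = 1 := by
          have := Nat.pos_of_ne_zero (NeZero.ne L); omega
        have hxy : x = y := by
          subst hL1
          funext i
          exact Subsingleton.elim _ _
        rw [hxy, sub_self, mul_zero, zero_sub]
        have h1 : 0 ≤ K * Q (ext v) := by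
          have := hcoer v
          have := hDnn (ext v)
          nlinarith [mul_nonneg hK.le (mul_nonneg hc₀.le (hDnn (ext v)))]
        have h2 : 0 ≤ 64 / (c₀ * K) := by positivity
        linarith
    have hmain := gph_cos_integral_ge' hSpd b hGv
    simp only [hbv] at hmain
    have h32 : (1 - 64 / (c₀ * K) / 2) = 1 - 32 / (c₀ * K) := by ring
    rw [h32] at hmain
    simp_rw [hg]
    exact hmain
  -- the observable as a double sum of cosines, and integrability
  have hO : ∀ v, O (ext v) = (∑ x, ∑ y, Real.cos (ext v (x, 0) - ext v (y, 0))) / (L : ℝ) ^ 4 := by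
    intro v
    show ‖∑ x : TorusSite 2 L, cexp (I * (ext v (x, 0) : ℂ))‖ ^ 2 / (L : ℝ) ^ 4 = _
    rw [sw_norm_sq_sum_cexp]
  have hext_pt : ∀ i : Λ L M, Continuous fun v : {i : Λ L M // i ≠ 0} → ℝ => ext v i := by
    intro i
    by_cases h : i = 0
    · have he : (fun v : {i : Λ L M // i ≠ 0} → ℝ => ext v i) = fun _ => 0 := by
        funext v; exact dif_pos h
      rw [he]; exact continuous_const
    · have he : (fun v : {i : Λ L M // i ≠ 0} → ℝ => ext v i) = fun v => v ⟨i, h⟩ := by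
        funext v; exact dif_neg h
      rw [he]; exact continuous_apply _
  have hg_c : Continuous g := by
    have : Continuous fun v : {i : Λ L M // i ≠ 0} → ℝ => Real.exp (-(1 / 2) * (v ⬝ᵥ (S *ᵥ v))) := by
      refine Real.continuous_exp.comp (continuous_const.mul ?_)
      exact continuous_id.dotProduct (continuous_const.matrix_mulVec continuous_id)
    exact this.congr fun v => (hg v).symm
  have hg_int : Integrable g := by
    have := gph_gauss_integrable hSpd
    exact this.congr (Filter.Eventually.of_forall fun v => (hg v).symm)
  have hint : ∀ x y : TorusSite 2 L,
      Integrable (fun v => Real.cos (ext v (x, 0) - ext v (y, 0)) * g v) := by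
    intro x y
    refine hg_int.mono' ?_ (Filter.Eventually.of_forall fun v => ?_)
    · refine Continuous.aestronglyMeasurable ?_
      exact ((Real.continuous_cos.comp ((hext_pt _).sub (hext_pt _))).mul hg_c)
    · have hgp : 0 < g v := by rw [hg]; exact Real.exp_pos _
      rw [Real.norm_eq_abs, abs_mul, abs_of_pos hgp]
      exact mul_le_of_le_one_left hgp.le (Real.abs_cos_le_one _)
  -- assemble
  have hL : (0 : ℝ) < L := by exact_mod_cast Nat.pos_of_ne_zero (NeZero.ne L)
  have hcard : (Finset.univ : Finset (TorusSite 2 L)).card = L ^ 2 := by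
    rw [Finset.card_univ, birLat_card_slice]
  have hrw : ∀ v, O (ext v) * g v =
      (1 / (L : ℝ) ^ 4) * ∑ x, ∑ y, Real.cos (ext v (x, 0) - ext v (y, 0)) * g v := by
    intro v
    rw [hO, div_mul_eq_mul_div, Finset.sum_mul]
    simp_rw [Finset.sum_mul]
    ring
  simp_rw [hrw]
  rw [integral_const_mul, integral_finsetSum _ (fun x _ => integrable_finsetSum _ fun y _ => hint x y)]
  have hstep : ∀ x : TorusSite 2 L,
      ∫ v, ∑ y, Real.cos (ext v (x, 0) - ext v (y, 0)) * g v = ∑ y, ∫ v, Real.cos (ext v (x, 0) - ext v (y, 0)) * g v :=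
    fun x => integral_finsetSum _ fun y _ => hint x y
  simp_rw [hstep]
  have hsum : ∑ x : TorusSite 2 L, ∑ y : TorusSite 2 L, (1 - 32 / (c₀ * K)) * ∫ v, g v ≤
      ∑ x : TorusSite 2 L, ∑ y : TorusSite 2 L, ∫ v, Real.cos (ext v (x, 0) - ext v (y, 0)) * g v :=
    Finset.sum_le_sum fun x _ => Finset.sum_le_sum fun y _ => hpair x y
  have hconst : ∑ x : TorusSite 2 L, ∑ y : TorusSite 2 L, (1 - 32 / (c₀ * K)) * ∫ v, g v =
      (L : ℝ) ^ 4 * ((1 - 32 / (c₀ * K)) * ∫ v, g v) := by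
    rw [Finset.sum_const, Finset.sum_const, hcard, nsmul_eq_mul, nsmul_eq_mul]
    push_cast
    ring
  rw [hconst] at hsum
  have hL4 : (0 : ℝ) < (L : ℝ) ^ 4 := by positivity
  calc (1 - 32 / (c₀ * K)) * ∫ v, g v
      = (1 / (L : ℝ) ^ 4) * ((L : ℝ) ^ 4 * ((1 - 32 / (c₀ * K)) * ∫ v, g v)) := by
        field_simp
    _ ≤ (1 / (L : ℝ) ^ 4) * ∑ x : TorusSite 2 L, ∑ y : TorusSite 2 L,
          ∫ v, Real.cos (ext v (x, 0) - ext v (y, 0)) * g v :=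
        mul_le_mul_of_nonneg_left hsum (by positivity)

/-- **Corollary — the crux's quantifier shape at the Gaussian level.**  With the threshold `K₀ = 64/c₀`,
independent of the table, of `L` and of `M`: for every `K ≥ 64/c₀`, every table with (N) and (C) and all
`L ≤ M`, the spin-wave slice order is at least one half, `(1/2) · ∫γ ≤ ∫ |Σ_x e^{i(ext v)(x,0)}|²/L⁴ dγ(v)`.
[folklore] -/
theorem birComplexStableXYR_spinWave_half (hr : 2 ≤ r) {c₀ : ℝ} (hc₀ : 0 < c₀) {K : ℝ} (hK : 64 / c₀ ≤ K)
    (c : Table r) (hN : c.sum (fun _ a => a) = 0)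
    (hC : ∀ φ : W r → ℝ, c₀ * ∑ w, ∑ w', (1 - Real.cos (φ w - φ w')) ≤ (genF c φ).re)
    (L M : ℕ) [NeZero L] [NeZero M] (hLM : L ≤ M) :
    let Q : (Λ L M → ℝ) → ℝ := fun u =>
      (-∑ s : Λ L M, c.sum (fun n a => a * (((∑ w, (n w : ℝ) * u (sh L M s w)) ^ 2 : ℝ) : ℂ))).re
    let ext : ({i : Λ L M // i ≠ 0} → ℝ) → Λ L M → ℝ := fun v i => if h : i = 0 then 0 else v ⟨i, h⟩
    let g : ({i : Λ L M // i ≠ 0} → ℝ) → ℝ := fun v => Real.exp (-(K / 2) * Q (ext v))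
    let O : (Λ L M → ℝ) → ℝ := fun θ =>
      ‖∑ x : TorusSite 2 L, cexp (I * (θ (x, 0) : ℂ))‖ ^ 2 / (L : ℝ) ^ 4
    0 < ∫ v, g v ∧ (1 / 2 : ℝ) * ∫ v, g v ≤ ∫ v, O (ext v) * g v := by
  intro Q ext g O
  have h64 : 0 < 64 / c₀ := by positivity
  have hKpos : 0 < K := lt_of_lt_of_le h64 hK
  obtain ⟨hZ, hmain⟩ := birComplexStableXYR_spinWave hr c hc₀ hN hC hKpos L M hLM
  refine ⟨hZ, le_trans (mul_le_mul_of_nonneg_right ?_ hZ.le) hmain⟩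
  have h1 : 64 ≤ K * c₀ := (div_le_iff₀ hc₀).1 hK
  have h2 : 32 / (c₀ * K) ≤ 1 / 2 := by
    rw [div_le_iff₀ (by positivity)]
    linarith
  linarith

/-- **Corollary — the harmonic approximation of the COMPLEX measure.**  Under (R)∧(P) the summed complex
Hessian is real (`gaussianReality`), so the complex spin-wave weight `exp(−(K/2)·H_c^Σ(ext v))` has non-zero
mass and slice-order ratio with real part `≥ 1 − 32/(c₀K)` (the crux's conclusion in shape), all `L ≤ M`. [folklore] -/
theorem birComplexStableXYR_spinWave_complex (hr : 2 ≤ r) (c : Table r) {c₀ : ℝ} (hc₀ : 0 < c₀)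
    (hN : c.sum (fun _ a => a) = 0)
    (hC : ∀ φ : W r → ℝ, c₀ * ∑ w, ∑ w', (1 - Real.cos (φ w - φ w')) ≤ (genF c φ).re)
    (hR : ∀ n : Freq r, c (fun w => n (w.1, w.2.1, Fin.rev w.2.2)) = conj (c (-n)))
    (hP : ∀ n : Freq r, c (fun w => n (Fin.rev w.1, Fin.rev w.2.1, w.2.2)) = c n)
    {K : ℝ} (hK : 0 < K) (L M : ℕ) [NeZero L] [NeZero M] (hLM : L ≤ M) :
    let Qc : (Λ L M → ℝ) → ℂ := fun u =>
      -∑ s : Λ L M, c.sum (fun n a => a * (((∑ w, (n w : ℝ) * u (sh L M s w)) ^ 2 : ℝ) : ℂ))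
    let ext : ({i : Λ L M // i ≠ 0} → ℝ) → Λ L M → ℝ := fun v i => if h : i = 0 then 0 else v ⟨i, h⟩
    let gc : ({i : Λ L M // i ≠ 0} → ℝ) → ℂ := fun v => cexp (-((K / 2 : ℝ) : ℂ) * Qc (ext v))
    let O : (Λ L M → ℝ) → ℝ := fun θ =>
      ‖∑ x : TorusSite 2 L, cexp (I * (θ (x, 0) : ℂ))‖ ^ 2 / (L : ℝ) ^ 4
    (∫ v, gc v) ≠ 0 ∧ 1 - 32 / (c₀ * K) ≤ ((∫ v, (O (ext v) : ℂ) * gc v) / ∫ v, gc v).re := by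
  intro Qc ext gc O
  obtain ⟨hZ, hmain⟩ := birComplexStableXYR_spinWave hr c hc₀ hN hC hK L M hLM
  have hreal : ∀ v, Qc (ext v) = (((Qc (ext v)).re : ℝ) : ℂ) := by
    intro v
    have him : (Qc (ext v)).im = 0 := by
      show (-∑ s : Λ L M, c.sum (fun n a => a * (((∑ w, (n w : ℝ) * ext v (sh L M s w)) ^ 2 : ℝ) : ℂ))).im = 0
      rw [Complex.neg_im, gaussianReality c hR hP L M (ext v), neg_zero]
    exact Complex.ext (by simp) (by rw [him, Complex.ofReal_im])
  have hgc : ∀ v, gc v = ((Real.exp (-(K / 2) * (Qc (ext v)).re) : ℝ) : ℂ) := by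
    intro v
    show cexp (-((K / 2 : ℝ) : ℂ) * Qc (ext v)) = _
    rw [Complex.ofReal_exp]
    congr 1
    conv_lhs => rw [hreal v]
    push_cast
    ring
  have hI1 : (∫ v, gc v) = ((∫ v, Real.exp (-(K / 2) * (Qc (ext v)).re) : ℝ) : ℂ) := by
    rw [← integral_complex_ofReal]; exact integral_congr_ae (Filter.Eventually.of_forall hgc)
  have hI2 : (∫ v, (O (ext v) : ℂ) * gc v) =
      ((∫ v, O (ext v) * Real.exp (-(K / 2) * (Qc (ext v)).re) : ℝ) : ℂ) := by
    rw [← integral_complex_ofReal]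
    refine integral_congr_ae (Filter.Eventually.of_forall fun v => ?_)
    show (O (ext v) : ℂ) * gc v = _
    rw [hgc v]
    push_cast
    ring
  have hZ' : 0 < ∫ v, Real.exp (-(K / 2) * (Qc (ext v)).re) := hZ
  refine ⟨by rw [hI1]; exact_mod_cast hZ'.ne', ?_⟩
  rw [hI1, hI2, ← Complex.ofReal_div, Complex.ofReal_re, le_div_iff₀ hZ']
  exact hmain

end SpinWave

end Summit.HubbardSuperconductivity.HubbardSuperconductivity.Theorems
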